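import Summits.ResolutionOfSingularities.ResolutionOfSingularities.Theorems.HilbertSamuelEliminationSigmaMaxModificationsCorridor3SigmaBoundaryElimination
import Summits.ResolutionOfSingularities.ResolutionOfSingularities.Theorems.HilbertSamuelEliminationSigmaMaxModificationsCorridor3SigmaMenuNonempty
import HarnessLib

/-!
# [OURS · L1 W4.2] THE E6 SOCKET AT THE HYBRID STRATEGY `π.hybrid τ`: a menu-disciplined functional policy over a functional fallback that
# steps only while the stratum is non-empty, on a good run-wise scope — «no infinite closed marked near chain from any closed point of
# `Y(ν)`» ⇒ the run TERMINATES ⇒ a `ν`-elimination ⇒ the line's `ν`-modification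
# (cell res-hironaka, LADDER-RESOLUTION rung L; slot W4.2, crux chain w42 `SigmaMaxModificationsCorridor3` stmt-ResolutionOfSingularities-19249 /
# crux stmt-…-18506; res-L1-w42-plan-1 RULING v3.14-16 (EL) 2026-08-27T11:37:09Z; hand res-D-pv-047 AS res-L1-s46-pv-10; reader res-L1-w42-lead-1
# (E6 owner); `--supports stmt-ResolutionOfSingularities-19249 --as helper`)

HONEST FRAMING. OURS proof architecture: the INSTANTIATION of the σE-compactness headline (`nuMod_of_forall_noInfiniteNearChainσE`, p527149) at the
hybrid strategies of res-L1-type-o1's menu layer (`StrategyE.hybrid`, `StrategyE.IsMenuDisciplined`, `StateScopeGood`, `isAdmissibleStrategyOnE_hybrid_plus`,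
`StrategyE.IsFunctional.hybrid`, `StrategyE.IsMenuDisciplined.stepsOnlyWhileNonempty_hybrid`; p526241 / p527045 / `…SigmaMenuNonempty.lean`). NOTHING is a
statement of H. Hironaka's manuscript [Hironaka2017] nor of Cossart–Jannsen–Saito; no named fact is introduced. AI-written; AI review is weaker than
expert review.

## What is here (namespace `…Theorems.SigmaMaxModificationsCorridor3.Sigma`)

For a POLICY `π : StrategyE` that is MENU-DISCIPLINED (every step's centre is a regular member of the Plus menu at a point of the `ν`-stratum) and FUNCTIONAL,
a FALLBACK `τ : StrategyE` that is functional, steps only while the stratum is non-empty, satisfies clause (a) (permissible centres inside the stratum,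
non-empty while it is) and is TOTAL on the run-wise scope of the hybrid, and a GOOD run-wise scope (`StateScopeGood` on
`StrategyE.RunReachableState p (π.hybrid τ) N ν E₀`: stages reduced, excellent, `dim ≤ N`, closed `ν`-stratum — a HYPOTHESIS here, to be wired from
`IsMaximalOrigin` + the cycle invariant / res-type-064's Bennett package when landed), with `ν ≠ Φ^{(N)}`:

* `hybrid_isAdmissibleOnRunReachable` — admissibility of `π.hybrid τ` on ITS run-wise scope (o1's plug `isAdmissibleStrategyOnE_hybrid_plus`);
  functionality and «steps only while non-empty» of the hybrid are o1's `StrategyE.IsFunctional.hybrid` /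
  `StrategyE.IsMenuDisciplined.stepsOnlyWhileNonempty_hybrid`, used BY NAME;
* **`runTerminatesσE_hybrid_of_forall_noInfiniteNearChain`** — from a maximal origin `(X, x)`, if NO closed `y ∈ X(ν)` starts an infinite
  `(π.hybrid τ)`-near chain of closed marked E-stages, the hybrid run from `X` TERMINATES;
* **`exists_isNuElimination_hybrid_of_forall_noInfiniteNearChain`** — hence a `ν`-elimination of `X` exists (CJS Def. 6.14);
* **`nuMod_of_hybrid_noInfiniteNearChain`** — hence, at level `3`, the line's `ν`-modification `TameWild.NuMod Y 3 d ν` (`d ≥ dim Y`);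
* the fallback OF RECORD `τ := StrategyE.ofStageOracleE ω` (the boundary-aware cycle-disciplined step of a FUNCTIONAL boundary-aware stage oracle,
  p523856): `nuMod_of_hybrid_ofStageOracleE_noInfiniteNearChain`, where `τ`'s functionality and «steps only while non-empty» are DISCHARGED
  (`StrategyE.isFunctional_ofStageOracleE`, `StrategyE.stepsOnlyWhileNonempty_ofStageOracleE`) and only its clause (a) / totality on the scope remain
  as hypotheses (Ω⁺E admissibility, res-type-040's cut).

What the E6 owner is LEFT WITH: «∀ y′ closed ∈ Y(ν), no infinite `(π.hybrid τ)`-near chain from `MarkedStageE.init Y y′ (E₀ Y y)`» — the σE-rows.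

## References (context)

* V. Cossart, U. Jannsen, S. Saito, LNM 2270 (2020), Rem. 6.29 (1), Def. 6.14, Thm. 3.10 (1). [CossartJannsenSaito2020]
-/

noncomputable section

set_option linter.dupNamespace false -- mandated namespace of this single-conjunct summit

open CategoryTheory AlgebraicGeometry TopologicalSpace Topology
open Summit.ResolutionOfSingularities.ResolutionOfSingularities.Theorems.CampaignW42
open Literature.AlgebraicGeometry.Resolution Literature.RingTheory.HilbertSamuel
open Literature.AlgebraicGeometry.CossartJannsenSaito2020

namespace Summit.ResolutionOfSingularities.ResolutionOfSingularities.Theorems.SigmaMaxModificationsCorridor3.Sigma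

universe u

section Hybrid

variable {p N : ℕ} {ν : ℕ → ℕ} {π τ : StrategyE.{u}} {E₀ : ∀ (X : Scheme.{u}), X → Boundary X}

/-- **The hybrid is ADMISSIBLE ON ITS RUN-WISE SCOPE** when the scope is good, `ν ≠ Φ^{(N)}`, the policy is menu-disciplined and the fallback satisfies
clause (a) and is total there (o1's plug of record `isAdmissibleStrategyOnE_hybrid_plus`). [cite: CossartJannsenSaito2020, Def. 3.1, Rem. 6.29 (1)] -/
theorem hybrid_isAdmissibleOnRunReachable (hπd : π.IsMenuDisciplined N ν)
    (h𝒮 : StateScopeGood N ν (StrategyE.RunReachableState p (π.hybrid τ) N ν E₀)) (hν : ν ≠ iterPSum N Phi)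
    (hτa : ∀ (W : Scheme.{u}) (hW : IsLocallyNoetherian W) (L : Labelling W) (P : Option (Pending W)) (E : Boundary W),
      StrategyE.RunReachableState p (π.hybrid τ) N ν E₀ W hW L P E →
      ∀ (C : W.IdealSheafData) (P' : Option (Pending (blowup C))), τ.step W hW N ν L P E C P' →
        IdealSheafData.IsPermissible C ∧ (C.support : Set W) ⊆ Scheme.hsStratum W N ν ∧
          ((Scheme.hsStratum W N ν).Nonempty → (C.support : Set W).Nonempty))
    (hτt : ∀ (W : Scheme.{u}) (hW : IsLocallyNoetherian W) (L : Labelling W) (P : Option (Pending W)) (E : Boundary W),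
      StrategyE.RunReachableState p (π.hybrid τ) N ν E₀ W hW L P E →
      (Scheme.hsStratum W N ν).Nonempty → ∃ (C : W.IdealSheafData) (P' : Option (Pending (blowup C))), τ.step W hW N ν L P E C P') :
    IsAdmissibleStrategyOnE (StrategyE.RunReachableState p (π.hybrid τ) N ν E₀) N ν (π.hybrid τ) :=
  isAdmissibleStrategyOnE_hybrid_plus hπd h𝒮 hν hτa hτt

/-- **NO INFINITE `(π.hybrid τ)`-NEAR CHAIN FROM ANY CLOSED POINT OF `X(ν)` ⇒ THE HYBRID RUN TERMINATES** (maximal origin `(X, x)`; hypotheses as in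
the module docstring). [cite: CossartJannsenSaito2020, Rem. 6.29 (1), p. 107] -/
theorem runTerminatesσE_hybrid_of_forall_noInfiniteNearChain (hπd : π.IsMenuDisciplined N ν) (hπf : π.IsFunctional N ν)
    (hτf : τ.IsFunctional N ν) (hτne : τ.StepsOnlyWhileNonempty N ν)
    (h𝒮 : StateScopeGood N ν (StrategyE.RunReachableState p (π.hybrid τ) N ν E₀)) (hν : ν ≠ iterPSum N Phi)
    (hτa : ∀ (W : Scheme.{u}) (hW : IsLocallyNoetherian W) (L : Labelling W) (P : Option (Pending W)) (E : Boundary W),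
      StrategyE.RunReachableState p (π.hybrid τ) N ν E₀ W hW L P E →
      ∀ (C : W.IdealSheafData) (P' : Option (Pending (blowup C))), τ.step W hW N ν L P E C P' →
        IdealSheafData.IsPermissible C ∧ (C.support : Set W) ⊆ Scheme.hsStratum W N ν ∧
          ((Scheme.hsStratum W N ν).Nonempty → (C.support : Set W).Nonempty))
    (hτt : ∀ (W : Scheme.{u}) (hW : IsLocallyNoetherian W) (L : Labelling W) (P : Option (Pending W)) (E : Boundary W),
      StrategyE.RunReachableState p (π.hybrid τ) N ν E₀ W hW L P E →
      (Scheme.hsStratum W N ν).Nonempty → ∃ (C : W.IdealSheafData) (P' : Option (Pending (blowup C))), τ.step W hW N ν L P E C P')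
    {X : Scheme.{u}} [hX : IsLocallyNoetherian X] {x : X} (hx : IsMaximalOrigin p N ν X x)
    (hno : ∀ y : X, y ∈ Scheme.hsStratum X N ν → IsClosed ({y} : Set X) →
      ¬ ∃ c : ℕ → MarkedStageE.{u}, c 0 = MarkedStageE.init X y (E₀ X x) ∧
        ∀ n, CanonicalNearStepσE (π.hybrid τ) N ν (c n) (c (n + 1))) :
    RunTerminatesσE (π.hybrid τ) N ν X (E₀ X x) :=
  runTerminatesσE_of_forall_noInfiniteNearChainσE (hπf.hybrid hτf) (hπd.stepsOnlyWhileNonempty_hybrid hτne)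
    (hybrid_isAdmissibleOnRunReachable hπd h𝒮 hν hτa hτt) hx hno

/-- **… ⇒ A `ν`-ELIMINATION OF `X` EXISTS.** [cite: CossartJannsenSaito2020, Def. 6.14] -/
theorem exists_isNuElimination_hybrid_of_forall_noInfiniteNearChain (hπd : π.IsMenuDisciplined N ν) (hπf : π.IsFunctional N ν)
    (hτf : τ.IsFunctional N ν) (hτne : τ.StepsOnlyWhileNonempty N ν)
    (h𝒮 : StateScopeGood N ν (StrategyE.RunReachableState p (π.hybrid τ) N ν E₀)) (hν : ν ≠ iterPSum N Phi)
    (hτa : ∀ (W : Scheme.{u}) (hW : IsLocallyNoetherian W) (L : Labelling W) (P : Option (Pending W)) (E : Boundary W),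
      StrategyE.RunReachableState p (π.hybrid τ) N ν E₀ W hW L P E →
      ∀ (C : W.IdealSheafData) (P' : Option (Pending (blowup C))), τ.step W hW N ν L P E C P' →
        IdealSheafData.IsPermissible C ∧ (C.support : Set W) ⊆ Scheme.hsStratum W N ν ∧
          ((Scheme.hsStratum W N ν).Nonempty → (C.support : Set W).Nonempty))
    (hτt : ∀ (W : Scheme.{u}) (hW : IsLocallyNoetherian W) (L : Labelling W) (P : Option (Pending W)) (E : Boundary W),
      StrategyE.RunReachableState p (π.hybrid τ) N ν E₀ W hW L P E →
      (Scheme.hsStratum W N ν).Nonempty → ∃ (C : W.IdealSheafData) (P' : Option (Pending (blowup C))), τ.step W hW N ν L P E C P')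
    {X : Scheme.{u}} [hX : IsLocallyNoetherian X] {x : X} (hx : IsMaximalOrigin p N ν X x)
    (hno : ∀ y : X, y ∈ Scheme.hsStratum X N ν → IsClosed ({y} : Set X) →
      ¬ ∃ c : ℕ → MarkedStageE.{u}, c 0 = MarkedStageE.init X y (E₀ X x) ∧
        ∀ n, CanonicalNearStepσE (π.hybrid τ) N ν (c n) (c (n + 1))) :
    ∃ s : CentreSeq X, s.IsNuElimination N ν :=
  exists_isNuElimination_of_runTerminatesσE (hybrid_isAdmissibleOnRunReachable hπd h𝒮 hν hτa hτt) hx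
    (runTerminatesσE_hybrid_of_forall_noInfiniteNearChain hπd hπf hτf hτne h𝒮 hν hτa hτt hx hno)

end Hybrid

section Packaging

variable {p : ℕ} {ν : ℕ → ℕ} {π τ : StrategyE.{0}} {E₀ : ∀ (X : Scheme.{0}), X → Boundary X}

/-- **THE E6 SOCKET AT THE HYBRID — `TameWild.NuMod Y 3 d ν`**: a menu-disciplined functional policy `π` over a functional fallback `τ` stepping only while
the stratum is non-empty, with clause (a) and totality of `τ` and goodness on the run-wise scope of `π.hybrid τ`, `ν ≠ Φ^{(3)}`, a threefold maximal-origin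
datum `(Y, y)` with `dim Y ≤ d`, and NO infinite `(π.hybrid τ)`-near chain of closed marked E-stages from any closed `y′ ∈ Y(ν)` ⇒ the line's
`ν`-modification (through `nuMod_of_forall_noInfiniteNearChainσE`, p527149, and the tree's `TameWild.nuMod_of_isNuElimination`).
[cite: CossartJannsenSaito2020, Def. 6.14, Thm. 3.10 (1)] -/
theorem nuMod_of_hybrid_noInfiniteNearChain (hπd : π.IsMenuDisciplined 3 ν) (hπf : π.IsFunctional 3 ν)
    (hτf : τ.IsFunctional 3 ν) (hτne : τ.StepsOnlyWhileNonempty 3 ν)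
    (h𝒮 : StateScopeGood 3 ν (StrategyE.RunReachableState p (π.hybrid τ) 3 ν E₀)) (hν : ν ≠ iterPSum 3 Phi)
    (hτa : ∀ (W : Scheme.{0}) (hW : IsLocallyNoetherian W) (L : Labelling W) (P : Option (Pending W)) (E : Boundary W),
      StrategyE.RunReachableState p (π.hybrid τ) 3 ν E₀ W hW L P E →
      ∀ (C : W.IdealSheafData) (P' : Option (Pending (blowup C))), τ.step W hW 3 ν L P E C P' →
        IdealSheafData.IsPermissible C ∧ (C.support : Set W) ⊆ Scheme.hsStratum W 3 ν ∧
          ((Scheme.hsStratum W 3 ν).Nonempty → (C.support : Set W).Nonempty))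
    (hτt : ∀ (W : Scheme.{0}) (hW : IsLocallyNoetherian W) (L : Labelling W) (P : Option (Pending W)) (E : Boundary W),
      StrategyE.RunReachableState p (π.hybrid τ) 3 ν E₀ W hW L P E →
      (Scheme.hsStratum W 3 ν).Nonempty → ∃ (C : W.IdealSheafData) (P' : Option (Pending (blowup C))), τ.step W hW 3 ν L P E C P')
    {Y : Scheme.{0}} [hY : IsLocallyNoetherian Y] {y : Y} (hy : IsMaximalOrigin p 3 ν Y y) {d : ℕ}
    (hd : topologicalKrullDim Y ≤ (d : WithBot ℕ∞))
    (hno : ∀ y' : Y, y' ∈ Scheme.hsStratum Y 3 ν → IsClosed ({y'} : Set Y) →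
      ¬ ∃ c : ℕ → MarkedStageE.{0}, c 0 = MarkedStageE.init Y y' (E₀ Y y) ∧
        ∀ n, CanonicalNearStepσE (π.hybrid τ) 3 ν (c n) (c (n + 1))) :
    TameWild.NuMod Y 3 d ν :=
  nuMod_of_forall_noInfiniteNearChainσE (hπf.hybrid hτf) (hπd.stepsOnlyWhileNonempty_hybrid hτne)
    (hybrid_isAdmissibleOnRunReachable hπd h𝒮 hν hτa hτt) hy hd hno

/-- **THE SAME WITH THE FALLBACK OF RECORD `τ := StrategyE.ofStageOracleE ω`** (the boundary-aware cycle-disciplined step of a FUNCTIONAL boundary-aware stage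
oracle — σ_CJS-with-boundary, Ω⁺E, …; p523856): its functionality and «steps only while non-empty» are DISCHARGED
(`StrategyE.isFunctional_ofStageOracleE`, `StrategyE.stepsOnlyWhileNonempty_ofStageOracleE`); its clause (a) and totality on the scope stay as
hypotheses (the Ω⁺E admissibility of res-type-040's cut). [cite: CossartJannsenSaito2020, Rem. 6.29 (1), Def. 6.14, Thm. 3.10 (1)] -/
theorem nuMod_of_hybrid_ofStageOracleE_noInfiniteNearChain {ω : StageOracleE.{0}} (hπd : π.IsMenuDisciplined 3 ν)
    (hπf : π.IsFunctional 3 ν) (hω : OracleFunctionalΩE ω)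
    (h𝒮 : StateScopeGood 3 ν (StrategyE.RunReachableState p (π.hybrid (StrategyE.ofStageOracleE ω)) 3 ν E₀))
    (hν : ν ≠ iterPSum 3 Phi)
    (hτa : ∀ (W : Scheme.{0}) (hW : IsLocallyNoetherian W) (L : Labelling W) (P : Option (Pending W)) (E : Boundary W),
      StrategyE.RunReachableState p (π.hybrid (StrategyE.ofStageOracleE ω)) 3 ν E₀ W hW L P E →
      ∀ (C : W.IdealSheafData) (P' : Option (Pending (blowup C))), IsCanonicalStepΩE ω hW 3 ν L E P C P' →
        IdealSheafData.IsPermissible C ∧ (C.support : Set W) ⊆ Scheme.hsStratum W 3 ν ∧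
          ((Scheme.hsStratum W 3 ν).Nonempty → (C.support : Set W).Nonempty))
    (hτt : ∀ (W : Scheme.{0}) (hW : IsLocallyNoetherian W) (L : Labelling W) (P : Option (Pending W)) (E : Boundary W),
      StrategyE.RunReachableState p (π.hybrid (StrategyE.ofStageOracleE ω)) 3 ν E₀ W hW L P E →
      (Scheme.hsStratum W 3 ν).Nonempty →
        ∃ (C : W.IdealSheafData) (P' : Option (Pending (blowup C))), IsCanonicalStepΩE ω hW 3 ν L E P C P')
    {Y : Scheme.{0}} [hY : IsLocallyNoetherian Y] {y : Y} (hy : IsMaximalOrigin p 3 ν Y y) {d : ℕ}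
    (hd : topologicalKrullDim Y ≤ (d : WithBot ℕ∞))
    (hno : ∀ y' : Y, y' ∈ Scheme.hsStratum Y 3 ν → IsClosed ({y'} : Set Y) →
      ¬ ∃ c : ℕ → MarkedStageE.{0}, c 0 = MarkedStageE.init Y y' (E₀ Y y) ∧
        ∀ n, CanonicalNearStepσE (π.hybrid (StrategyE.ofStageOracleE ω)) 3 ν (c n) (c (n + 1))) :
    TameWild.NuMod Y 3 d ν :=
  nuMod_of_hybrid_noInfiniteNearChain hπd hπf (StrategyE.isFunctional_ofStageOracleE hω 3 ν)
    (StrategyE.stepsOnlyWhileNonempty_ofStageOracleE ω 3 ν) h𝒮 hν hτa hτt hy hd hno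

end Packaging

end Summit.ResolutionOfSingularities.ResolutionOfSingularities.Theorems.SigmaMaxModificationsCorridor3.Sigma

end
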